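import Summits.QuantumFields.YangMills.Theorems.BalabanUVNodesN20FinalLevelRatioDomination
import Literature.MathematicalPhysics.QuantumFieldTheory.Balaban1983to89.T4PersistentHistoryCount

/-!
# N20 (NE7b) ON THE TOWER-FREE ROAD, ITEM (c): THE BANKED BUDGET — «banked per-renewal credit, at least `(K − j)∕N` renewals ⇒ `Σ_X x(X) ≤ V·r^{K−j⋆+1}∕(1−r)`»,
# hence the weights `W_K = 1 − exp(−S_K)` (images good) ∕ `exp(S_K) − 1` of the final-level ratio-domination socket obey `0 ≤ W_K < 1` and `Σ_K W_K < ∞`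
# under the net survival-rate condition — the removal map `rm`, the fibre injections `φ` and the fibrewise letter hDom DISPLAYED as data ∕ hypotheses

Cell `pub-ymgap`, YM-PLAN Track A (HUMAN RULING D-0062); seat `pub-ymgap-dag-n20-d` (R134 (a) N20 NE7b s3 «W_K < 1, Σ W_K < ∞ from [B16] (1.79)–(1.89) pp. 383–387 directly
(`T4WeightBudget.RelWeightBound`)»), gen 40 = director-ym №374 line (E): «(c) the banking budget algebra typed ABSTRACTLY against `B16Lem384Induction` ∕ `B16Improved189FullBudget*` ∕
`T4PersistentHistoryCount` ∕ `…N20RenewalCurrency`, closing on p768103's `W = exp(Σ x) − 1` socket; rm and hDom DISPLAYED».  `--kind proof --supports stmt-QuantumFields-27366 --as helper`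
(K3⁸); COUNT-NEUTRAL; THEOREMS ONLY (0 `def`).  [IV] = [Balaban1989LargeFieldI]; [LF-II] = [Balaban1989LargeFieldII].  Companions BY NAME: `…N20FinalLevelRatioDomination` (gen 39,
p768103: `sum_integral_le_mul_sum_image_of_fibreDom`, `sum_le_exp_sub_one`, `sum_classWeightOfDatum₉_le_…`), `T4PersistentHistoryCount` (`slotBudget_model`, `slotPrice_le`, `records`,
`pow_four_mul_exp_lt_one_iff`), `T4HistoryPeeling` (`recordSum_le`, `pow_eventCount_le_twoRate`, `twoRateBudget_nonneg`, `summable_twoRateBudget`), `T4PeierlsDomination`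
(`le_weight_mul_add`), `T4WeightBudgetKP` (`weightKP_lt_one`, `summable_weightKP`), `T4WeightBudget` (`RelWeightBound`, `survivalRate`, `survivalRate_pos_iff`).

WHY.  Road [e] of record (№374, LOCATED-5 §2): at the FINAL level only, a bad class `B` of histories with a removal map `rm` (offending old components declared small) and ONE per-history
fibrewise letter hDom «`∫⌈_{fib s} t_s ≤ z(s)·∫⌈_{fib s} t_{rm s}`» ([LF-II] (1.79) p. 383 «holds for all large field regions» + (1.89)⁺ p. 387, READ on [IV] (0.3)'s fibre ratio — an ESTIMATE,
junction NC-NE7b-α, NOT here) is dominated class-wise with the fibre multiplicity `≤ exp(Σ_{X ∈ Old σ} x(X)) − 1` once each removal fibre injects (`φ σ`) into the non-empty sub-families of a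
stock `Old σ` of candidate components with `z(s) ≤ Π_{X ∈ φ σ s} x(X)` (p768103 §3).  ITEM (c) = the SMALLNESS of `Σ_X x(X)` — renewal arithmetic (LOCATED-5 §3): a candidate old component is
filed under its BIRTH SLOT (birth step `j < j⋆`, birth cell, `#cells ≤ V·Λ^{K−j}`, `Λ = L⁴`); the activities filed at one slot add up to at most the slot's PRICE; a slot's price is `≤ C·σ^{K−j}`
because a component pending at `K` was renewed (renewal or merger) at least `m₀ ≥ (K+1−j)∕N − 1` times, each event banking a credit `ρ = e^{−p}` (`p` = the banked part `c·p₀(g_K)` of the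
exponent — the surplus print SPENDS in the last step of (1.88) p. 387 and the cell's NE7b banks; NOT PRINTED) against a record entropy `Γ = e^{E}` per event (`T4HistoryPeeling.recordSum_le` +
`pow_eventCount_le_twoRate`: `σ = (Γρ)^{1∕N}`, `C = (Γρ)⁻¹∕(1 − Γρ)`), or — print's VARIABLE windows, records counted exactly — by `T4PersistentHistoryCount.slotPrice_le` (`σ = e^{η̄ − κ₁}`,
`C = ρ̄e^{−κ₁}`).  Summing the slots (`slotBudget_model`): `Σ_{X ∈ Old σ} x(X) ≤ S_K := C·V·(Λσ)^{K − j⋆ + 1}∕(1 − Λσ)` once `r = Λσ < 1`, i.e. (uniform window) iff `0 < survivalRate p E N L` iff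
`p₀∕N > (4∕c)·log L + E∕(cN)` (§3).  THE WEIGHTS: with GOOD images `rm s ∉ B` the socket's `exp(S) − 1` against the good mass is `W_K = 1 − exp(−S_K)` against the total (`le_weight_mul_add`):
`0 ≤ W_K < 1` for EVERY `K`, and `Σ_K W_K < ∞` when the age cut keeps a positive fraction of the steps old, `c′·K ≤ K − j⋆(K)` (`summable_twoRateBudget`); the raw socket `exp(S_K) − 1` is
summable likewise and `< 1` once `S_K < log 2` (§1, §3).

WHAT IS PROVED (kernel; finite sums, two real-analysis one-liners, the companions BY NAME; every analytic input a displayed hypothesis).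
§1 ★ `sum_integral_le_mul_sum_sdiff_of_fibreDom` (p768103 §2 with GOOD images: `Σ_B ∫t ≤ W·Σ_{univ∖B} ∫t`), ★★ `sum_integral_le_weightKP_mul_sum_of_fibreDom` (+ the compatible-family
   multiplicity ⇒ `Σ_B ∫t ≤ (1 − e^{−w})·Σ_univ ∫t`), `expWeight_lt_one_of_lt_log_two`, `summable_expWeight_of_le`.
§2 ★★ `sum_stock_le_twoRate_of_slotPrices` (a stock filed under birth slots, slot prices `≤ C·σ^{K−j}` ⇒ `≤ C·V·(Λσ)^{K−j⋆+1}∕(1−Λσ)`), ★★ `recordPrice_le_twoRate_of_uniformWindow` (THE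
   SENTENCE OF LINE (E): `≥ m₀` banked renewals with `K+1−j ≤ N(m₀+1)`, credit `ρ` each, entropy `Γ^k` ⇒ slot price `≤ (Γρ)⁻¹∕(1−Γρ)·((Γρ)^{1∕N})^{K−j}`), ★★★
   `sum_stock_le_twoRate_of_uniformWindow`, ★★★ `sum_stock_le_twoRate_of_records` (print's variable windows: `T4PersistentHistoryCount.slotPrice_le`).
§3 `twoRateBudget_le_head` (`S_K ≤ C·V·r∕(1−r)`), ★★ `weightKP_twoRate` (`0 ≤ 1 − e^{−S_K} < 1` ∀ K and `Σ_K (1 − e^{−S_K}) < ∞`), ★★ `expWeight_twoRate` (the raw socket: `0 ≤`, summable,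
   `< 1` once `C·V·r∕(1−r) < log 2`), `rpow_exp_entropy_credit`, ★ `twoRate_uniformWindow_lt_one_iff` (`L⁴·(e^{E}e^{−p})^{1∕N} < 1 ↔ 0 < survivalRate p E N L`), ★ `survivalRate_banked_pos_iff`
   (`p = c·p₀`: `↔ (4∕c)·log L + E∕(cN) < p₀∕N`).
§4 ★★ `relWeightBound_of_weightKP_le` (both runs' per-`(K,t)` inequalities at the weight `1 − e^{−S_K}`, `S ≥ 0` summable ⇒ `RelWeightBound`), ★★ `relWeightBound_twoRate_of_weightKP_le`;
   of record on the dressed class weights `classWeightOfDatum₉` of a Stage-9 tuple at one `(p, g, k, t)`: ★★★ `sum_classWeightOfDatum₉_le_weightKP_mul_sum_of_fibreDom` (p768103 §4's data +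
   good images ⇒ `Σ_B cw ≤ (1 − e^{−w})·Σ cw`), ★★★ `sum_classWeightOfDatum₉_le_weightKP_mul_sum_of_slotPrices` (w DISCHARGED by the slot budget), ★★★
   `sum_classWeightOfDatum₉_le_weightKP_mul_sum_of_uniformWindow` (w DISCHARGED by line (E)'s sentence: banked renewals, uniform window).

HONEST FRAMING.  [bookkeeping] + [folklore] real analysis.  The letter hDom is a HYPOTHESIS (an ESTIMATE — [LF-II] (1.79)∕(1.89)⁺'s KIND on [IV] (0.3)'s fibre ratio; junction NC-NE7b-α
UNRULED); the removal map `rm` (with «images good») and the fibre injections `φ σ` into a slot-filed stock are DATA (a DEFINER object on def-T's index — [IV] p. 177, def-R `PpSelOfRecord`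
docstring; post-campaign design memo per №374); the per-record ∕ per-event prices (`c r ≤ ρ^{m r}`, `hy`) are the cell's BANKING of print's credits (R1 — print spends them in (1.88); NOT
PRINTED), the record entropy `Γ^k`, the cell count `V·Λ^a` and the window statements are hypotheses exactly as in `T4HistoryPeeling` ∕ `T4PersistentHistoryCount`.  NO weight of Bałaban's
is bounded, NO estimate proved; NE7 ∕ NE7b ∕ NE7c NOT PRINTED for `d = 4` ∕ NOT proved; no `Stage9Params.Provisos` inhabitant claimed (K0⁷ OPEN); K3⁸ untouched; N20 NOT discharged; counts
UNMOVED (typed 28∕28 · discharged 8∕27); one finite four-torus programme at fixed `ε` — NOT ℝ⁴, NOT OS, NOT a mass gap, NOT the Clay problem.  No `def`, no `instance`, no `notation`, no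
`sorry`; no decl below carries a cite tag.
-/

noncomputable section

open MeasureTheory
open scoped BigOperators
open Finset

namespace YMDAG.UVSplit

open Literature.MathematicalPhysics.QuantumFieldTheory.Balaban1983to89
open Literature.MathematicalPhysics.QuantumFieldTheory.Balaban1983to89.T4Continuum
open Literature.MathematicalPhysics.QuantumFieldTheory.Balaban1983to89.Node00
open Literature.MathematicalPhysics.QuantumFieldTheory.Balaban1983to89.B15.BasicStep (fibreIntegral)
open T4WeightBudget (RelWeightBound survivalRate survivalRate_pos_iff)
open T4WeightBudgetKP (weightKP_lt_one summable_weightKP)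
open T4PeierlsDomination (le_weight_mul_add)
open T4HistoryPeeling (recordSum_le pow_eventCount_le_twoRate twoRateBudget_nonneg summable_twoRateBudget)
open T4PersistentHistoryCount (slotBudget_model slotPrice_le records pow_four_mul_exp_lt_one_iff)

/-! ## §1 The socket with GOOD images: `exp(w) − 1` against the good mass is `1 − exp(−w)` against the total -/

section Socket

variable {P : Params} {G : Type*} [GaugeGroup G] [MeasurableSpace G] [HaarData G] {j : ℕ}
variable {ι : Type*} [Fintype ι] [DecidableEq ι]

/-- ★ **A BAD CLASS WITH GOOD IMAGES WEIGHS AT MOST ITS FIBRE MULTIPLICITY TIMES THE GOOD CLASS.**  p768103's `sum_integral_le_mul_sum_image_of_fibreDom` when the removal map lands OUTSIDE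
the bad set (`rm s ∉ B` for `s ∈ B`: every offending component removed) and `0 ≤ W`: `Σ_{s∈B} ∫ t_s ≤ W · Σ_{s ∉ B} ∫ t_s`. [bookkeeping] -/
theorem sum_integral_le_mul_sum_sdiff_of_fibreDom {iP : DecidableEq (PBond P j)} (t : ι → Density P j G) (fib : ι → Finset (PBond P j))
    (B : Finset ι) (rm : ι → ι) (z : ι → ℝ) {W : ℝ} (hW0 : 0 ≤ W)
    (hm : ∀ s, Measurable (t s)) (h0 : ∀ s V, 0 ≤ t s V) (hint : ∀ s, Integrable (t s) (fieldMeasure P j G))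
    (hDom : ∀ s ∈ B, ∀ V, fibreIntegral (fib s) (t s) V ≤ z s * fibreIntegral (fib s) (t (rm s)) V)
    (hgood : ∀ s ∈ B, rm s ∉ B)
    (hW : ∀ σ ∈ B.image rm, ∑ s ∈ B.filter (fun s => rm s = σ), z s ≤ W) :
    ∑ s ∈ B, ∫ V, t s V ∂fieldMeasure P j G ≤ W * ∑ s ∈ univ \ B, ∫ V, t s V ∂fieldMeasure P j G := by
  have himg : B.image rm ⊆ univ \ B := by
    intro σ hσ
    obtain ⟨s, hs, rfl⟩ := Finset.mem_image.1 hσ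
    exact Finset.mem_sdiff.2 ⟨Finset.mem_univ _, hgood s hs⟩
  exact (sum_integral_le_mul_sum_image_of_fibreDom t fib B rm z hm h0 hint hDom hW).trans
    (mul_le_mul_of_nonneg_left (Finset.sum_le_sum_of_subset_of_nonneg himg fun s _ _ => integral_nonneg (h0 s)) hW0)

/-- ★★ **THE KP-SHAPED WEIGHT FROM THE FIBREWISE LETTER**: per-history fibrewise domination on the bad set with GOOD images, every removal fibre injecting into the non-empty compatible
sub-families of a stock `Old σ` with multiplicative majorants `z s ≤ Π_{X ∈ φ σ s} x X` (`0 ≤ x`) and the uniform smallness `Σ_{X ∈ Old σ} x X ≤ w` ⇒ the bad class weighs at most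
`1 − exp(−w)` OF THE TOTAL (p768103 §3 `sum_le_exp_sub_one` gives `exp(w) − 1` against the good mass; `T4PeierlsDomination.le_weight_mul_add` turns it around).  This is the per-run clause
of `RelWeightBound` with a weight `< 1` for every `w`. [bookkeeping] -/
theorem sum_integral_le_weightKP_mul_sum_of_fibreDom {X : Type*} [DecidableEq X] {iP : DecidableEq (PBond P j)} (t : ι → Density P j G)
    (fib : ι → Finset (PBond P j)) (B : Finset ι) (rm : ι → ι) (z : ι → ℝ)
    (hm : ∀ s, Measurable (t s)) (h0 : ∀ s V, 0 ≤ t s V) (hint : ∀ s, Integrable (t s) (fieldMeasure P j G))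
    (hDom : ∀ s ∈ B, ∀ V, fibreIntegral (fib s) (t s) V ≤ z s * fibreIntegral (fib s) (t (rm s)) V)
    (hgood : ∀ s ∈ B, rm s ∉ B)
    (Old : ι → Finset X) (φ : ι → ι → Finset X) (x : X → ℝ) {w : ℝ} (hx : ∀ σ, ∀ Y ∈ Old σ, 0 ≤ x Y)
    (hφ : ∀ σ, ∀ s ∈ B.filter (fun s => rm s = σ), φ σ s ⊆ Old σ ∧ (φ σ s).Nonempty) (hinj : ∀ σ, Set.InjOn (φ σ) (B.filter (fun s => rm s = σ)))
    (hz : ∀ σ, ∀ s ∈ B.filter (fun s => rm s = σ), z s ≤ ∏ Y ∈ φ σ s, x Y) (hw : ∀ σ, ∑ Y ∈ Old σ, x Y ≤ w) :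
    ∑ s ∈ B, ∫ V, t s V ∂fieldMeasure P j G ≤ (1 - Real.exp (-w)) * ∑ s, ∫ V, t s V ∂fieldMeasure P j G := by
  rcases isEmpty_or_nonempty ι with hι | hι
  · simp [Finset.eq_empty_of_isEmpty B, Finset.univ_eq_empty]
  · obtain ⟨i⟩ := hι
    have hw0 : 0 ≤ w := le_trans (Finset.sum_nonneg fun Y hY => hx (rm i) Y hY) (hw (rm i))
    have h1 := sum_integral_le_mul_sum_sdiff_of_fibreDom t fib B rm z (sub_nonneg.2 (Real.one_le_exp hw0)) hm h0 hint hDom hgood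
      fun σ _ => (sum_le_exp_sub_one _ (Old σ) (φ σ) z x (hx σ) (hφ σ) (hinj σ) (hz σ)).trans
        (sub_le_sub_right (Real.exp_le_exp.2 (hw σ)) 1)
    have h2 := le_weight_mul_add h1
    rwa [Finset.sum_sdiff (Finset.subset_univ B)] at h2

end Socket

section ExpWeight

/-- The raw socket weight `exp(w) − 1` is `< 1` as soon as `w < log 2`. [folklore] -/
theorem expWeight_lt_one_of_lt_log_two {w : ℝ} (hw : w < Real.log 2) : Real.exp w - 1 < 1 := by
  have h : Real.exp w < 2 := by
    calc Real.exp w < Real.exp (Real.log 2) := Real.exp_lt_exp.2 hw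
      _ = 2 := Real.exp_log (by norm_num)
  linarith

/-- Summability of the raw socket weights `exp(S K) − 1` from `0 ≤ S K ≤ S₀` and `Σ_K S K < ∞` (`exp(S) − 1 ≤ S·exp(S) ≤ S·exp(S₀)`, the first step from `1 − S ≤ exp(−S)` — the
tree's `AreaLaw.exp_sub_one_le_mul_exp` under another topic, re-derived inline rather than imported across topics). [folklore] -/
theorem summable_expWeight_of_le {S : ℕ → ℝ} {S₀ : ℝ} (hS0 : ∀ K, 0 ≤ S K) (hS1 : ∀ K, S K ≤ S₀) (hS : Summable S) :
    Summable (fun K => Real.exp (S K) - 1) := by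
  have hle : ∀ w : ℝ, Real.exp w - 1 ≤ w * Real.exp w := fun w => by
    have h1 : (-w + 1) * Real.exp w ≤ Real.exp (-w) * Real.exp w := mul_le_mul_of_nonneg_right (Real.add_one_le_exp (-w)) (Real.exp_pos w).le
    rw [← Real.exp_add, neg_add_cancel, Real.exp_zero] at h1
    nlinarith [h1, Real.exp_pos w]
  exact Summable.of_nonneg_of_le (fun K => sub_nonneg.2 (Real.one_le_exp (hS0 K)))
    (fun K => (hle (S K)).trans (mul_le_mul_of_nonneg_left (Real.exp_le_exp.2 (hS1 K)) (hS0 K))) (hS.mul_right (Real.exp S₀))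

end ExpWeight

/-! ## §2 The stock budget: candidates filed under birth slots; slot prices from banked renewals -/

section Stock

/-- ★★ **THE STOCK BUDGET FROM SLOT PRICES.**  Candidates filed under BIRTH SLOTS `slot Y = ⟨j, z⟩` — birth step `j < j⋆ ≤ K` (old), birth cell `z ∈ Cell (K − j)` with `#Cell a ≤ V·Λ^a` — and
the activities filed at each slot adding up to at most `C·σ^{K−j}` ⇒ `Σ_{Y ∈ Old} x Y ≤ C·V·(Λσ)^{K − j⋆ + 1}∕(1 − Λσ)` whenever `Λσ < 1` (`T4PersistentHistoryCount.slotBudget_model` =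
`T4WeightBudget.twoRate_majorant_le`). [folklore] -/
theorem sum_stock_le_twoRate_of_slotPrices {X γ : Type*} [DecidableEq γ] (Old : Finset X) (slot : X → (Σ _ : ℕ, γ)) (x : X → ℝ) (Cell : ℕ → Finset γ)
    {V Λ C σ : ℝ} (hV : 0 ≤ V) (hΛ : 0 ≤ Λ) (hC : 0 ≤ C) (hσ : 0 ≤ σ) (hr : Λ * σ < 1) (hcell : ∀ a, ((Cell a).card : ℝ) ≤ V * Λ ^ a)
    {jstar K : ℕ} (hj : jstar ≤ K) (hold : ∀ Y ∈ Old, (slot Y).1 < jstar) (hmem : ∀ Y ∈ Old, (slot Y).2 ∈ Cell (K - (slot Y).1))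
    (hprice : ∀ j < jstar, ∀ z ∈ Cell (K - j), ∑ Y ∈ Old with slot Y = ⟨j, z⟩, x Y ≤ C * σ ^ (K - j)) :
    ∑ Y ∈ Old, x Y ≤ C * V * ((Λ * σ) ^ (K - jstar + 1) / (1 - Λ * σ)) := by
  have hmaps : ∀ Y ∈ Old, slot Y ∈ (range jstar).sigma fun j => Cell (K - j) := fun Y hY =>
    Finset.mem_sigma.2 ⟨Finset.mem_range.2 (hold Y hY), hmem Y hY⟩
  calc ∑ Y ∈ Old, x Y = ∑ m ∈ (range jstar).sigma (fun j => Cell (K - j)), ∑ Y ∈ Old with slot Y = m, x Y :=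
        (Finset.sum_fiberwise_of_maps_to hmaps x).symm
    _ = ∑ j ∈ range jstar, ∑ z ∈ Cell (K - j), ∑ Y ∈ Old with slot Y = ⟨j, z⟩, x Y := Finset.sum_sigma _ _ _
    _ ≤ C * V * ((Λ * σ) ^ (K - jstar + 1) / (1 - Λ * σ)) :=
        slotBudget_model Cell hV hΛ hC hσ hr hcell hj (fun j z => ∑ Y ∈ Old with slot Y = ⟨j, z⟩, x Y) hprice

/-- ★★ **ONE SLOT'S PRICE FROM BANKED RENEWALS, UNIFORM WINDOW — the sentence of line (E).**  The records `Rec` filed at a slot born at `j ≤ K`, each with an event count `m r` (renewals and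
mergers after birth), a cost `c r ≤ ρ^{m r}` (each event BANKS the credit `ρ = e^{−p}`, `p` = the banked part `c·p₀(g_K)` of the exponent — NOT PRINTED: print spends it in (1.88)), at most
`Γ^k` records with `k` events, and AT LEAST `m₀` events each, where the uniform window gives `K + 1 − j ≤ N·(m₀ + 1)` (`T4WeightBudget.card_Icc_le_of_windows`: pending over `[j, K]` forces
`≥ (K+1−j)∕N − 1` renewals): the slot's price is `≤ (Γρ)⁻¹∕(1 − Γρ) · ((Γρ)^{1∕N})^{K − j}` (`T4HistoryPeeling.recordSum_le` + `pow_eventCount_le_twoRate`). [folklore] -/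
theorem recordPrice_le_twoRate_of_uniformWindow {R : Type*} (Rec : Finset R) (m : R → ℕ) (c : R → ℝ) {ρ Γ : ℝ} (hρ : 0 ≤ ρ) (hΓ : 0 ≤ Γ)
    (hq0 : 0 < Γ * ρ) (hq1 : Γ * ρ < 1) {N : ℕ} (hN : 0 < N) {m₀ j K : ℕ} (hjK : j ≤ K)
    (hc : ∀ r ∈ Rec, c r ≤ ρ ^ m r) (hcount : ∀ k, ((Rec.filter fun r => m r = k).card : ℝ) ≤ Γ ^ k)
    (hm : ∀ r ∈ Rec, m₀ ≤ m r) (hwin : K + 1 - j ≤ N * (m₀ + 1)) :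
    ∑ r ∈ Rec, c r ≤ (Γ * ρ)⁻¹ / (1 - Γ * ρ) * ((Γ * ρ) ^ ((1 : ℝ) / N)) ^ (K - j) := by
  have h1 : ∑ r ∈ Rec, c r ≤ (Γ * ρ) ^ m₀ / (1 - Γ * ρ) := recordSum_le Rec m c hρ hΓ hq1 hc hcount hm
  have h2 : (Γ * ρ) ^ m₀ ≤ (Γ * ρ)⁻¹ * ((Γ * ρ) ^ ((1 : ℝ) / N)) ^ (K + 1 - j) := pow_eventCount_le_twoRate hq0 hq1.le hN hwin
  have hs0 : 0 ≤ (Γ * ρ) ^ ((1 : ℝ) / N) := Real.rpow_nonneg hq0.le _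
  have hs1 : (Γ * ρ) ^ ((1 : ℝ) / N) ≤ 1 := Real.rpow_le_one hq0.le hq1.le (by positivity)
  have h3 : ((Γ * ρ) ^ ((1 : ℝ) / N)) ^ (K + 1 - j) ≤ ((Γ * ρ) ^ ((1 : ℝ) / N)) ^ (K - j) := by
    rw [show K + 1 - j = (K - j) + 1 by omega, pow_succ]
    exact mul_le_of_le_one_right (pow_nonneg hs0 _) hs1
  have h1q : 0 < 1 - Γ * ρ := by linarith
  calc ∑ r ∈ Rec, c r ≤ (Γ * ρ) ^ m₀ / (1 - Γ * ρ) := h1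
    _ ≤ (Γ * ρ)⁻¹ * ((Γ * ρ) ^ ((1 : ℝ) / N)) ^ (K - j) / (1 - Γ * ρ) :=
        div_le_div_of_nonneg_right (h2.trans (mul_le_mul_of_nonneg_left h3 (inv_nonneg.2 hq0.le))) h1q.le
    _ = (Γ * ρ)⁻¹ / (1 - Γ * ρ) * ((Γ * ρ) ^ ((1 : ℝ) / N)) ^ (K - j) := by ring

/-- ★★★ **THE STOCK BUDGET OF LINE (E) — uniform window.**  «Banked per-renewal credit `ρ = e^{−p}` (`p = c·p₀(g_K)`), at least `(K + 1 − j)∕N − 1` renewals for a component born at `j` and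
pending at `K`» ⇒ `Σ_{Y ∈ Old} x Y ≤ C·V·r^{K − j⋆ + 1}∕(1 − r)` with `r = Λ·(Γρ)^{1∕N}`, `C = (Γρ)⁻¹∕(1 − Γρ)`, whenever `r < 1`: the candidates filed under birth slots, the records at each
slot priced by `recordPrice_le_twoRate_of_uniformWindow`, the slots summed by `sum_stock_le_twoRate_of_slotPrices`. [folklore] -/
theorem sum_stock_le_twoRate_of_uniformWindow {X γ R : Type*} [DecidableEq γ] (Old : Finset X) (slot : X → (Σ _ : ℕ, γ)) (x : X → ℝ) (Cell : ℕ → Finset γ)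
    {V Λ ρ Γ : ℝ} (hV : 0 ≤ V) (hΛ : 0 ≤ Λ) (hρ : 0 ≤ ρ) (hΓ : 0 ≤ Γ) (hq0 : 0 < Γ * ρ) (hq1 : Γ * ρ < 1) {N : ℕ} (hN : 0 < N)
    (hr : Λ * (Γ * ρ) ^ ((1 : ℝ) / N) < 1) (hcell : ∀ a, ((Cell a).card : ℝ) ≤ V * Λ ^ a)
    {jstar K : ℕ} (hj : jstar ≤ K) (hold : ∀ Y ∈ Old, (slot Y).1 < jstar) (hmem : ∀ Y ∈ Old, (slot Y).2 ∈ Cell (K - (slot Y).1))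
    (Rec : ℕ → γ → Finset R) (m : ℕ → γ → R → ℕ) (c : ℕ → γ → R → ℝ) (m₀ : ℕ → ℕ)
    (hfile : ∀ j < jstar, ∀ z ∈ Cell (K - j), ∑ Y ∈ Old with slot Y = ⟨j, z⟩, x Y ≤ ∑ r ∈ Rec j z, c j z r)
    (hc : ∀ j < jstar, ∀ z ∈ Cell (K - j), ∀ r ∈ Rec j z, c j z r ≤ ρ ^ m j z r)
    (hcount : ∀ j < jstar, ∀ z ∈ Cell (K - j), ∀ k, (((Rec j z).filter fun r => m j z r = k).card : ℝ) ≤ Γ ^ k)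
    (hm : ∀ j < jstar, ∀ z ∈ Cell (K - j), ∀ r ∈ Rec j z, m₀ j ≤ m j z r) (hwin : ∀ j < jstar, K + 1 - j ≤ N * (m₀ j + 1)) :
    ∑ Y ∈ Old, x Y ≤ (Γ * ρ)⁻¹ / (1 - Γ * ρ) * V * ((Λ * (Γ * ρ) ^ ((1 : ℝ) / N)) ^ (K - jstar + 1) / (1 - Λ * (Γ * ρ) ^ ((1 : ℝ) / N))) := by
  have hC : 0 ≤ (Γ * ρ)⁻¹ / (1 - Γ * ρ) := div_nonneg (inv_nonneg.2 hq0.le) (by linarith)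
  refine sum_stock_le_twoRate_of_slotPrices Old slot x Cell hV hΛ hC (Real.rpow_nonneg hq0.le _) hr hcell hj hold hmem ?_
  intro j hjlt z hz
  exact (hfile j hjlt z hz).trans (recordPrice_le_twoRate_of_uniformWindow (Rec j z) (m j z) (c j z) hρ hΓ hq0 hq1 hN
    (le_trans (le_of_lt hjlt) hj) (hc j hjlt z hz) (hcount j hjlt z hz) (hm j hjlt z hz) (hwin j hjlt))

/-- ★★★ **THE STOCK BUDGET WITH PRINT'S VARIABLE WINDOWS** (records counted EXACTLY): the candidates filed under birth slots, the activities at a slot adding up to at most the sum over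
the birth kinds `b ∈ Bk j` and the records `Q ∈ records W j K (E j) b` of per-record prices `y j z b Q ≤ ρ b·e^{−κ₁ W b}·Π_{e∈Q}(e^{−κ₁ W e}·η e)` (each event's banked credit split as `κ₁ ×`
the window it pays for, times a residual `η e ≥ 0`; per-step residual entropy `≤ η̄`; birth residuals `Σ_b ρ b ≤ ρ̄` — `T4PersistentHistoryCount.slotPrice_le`) ⇒
`Σ_{Y ∈ Old} x Y ≤ (ρ̄ e^{−κ₁})·V·(Λσ)^{K − j⋆ + 1}∕(1 − Λσ)`, `σ = e^{η̄ − κ₁}`, whenever `Λσ < 1`. [folklore] -/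
theorem sum_stock_le_twoRate_of_records {X γ ε : Type*} [DecidableEq γ] [DecidableEq ε] (Old : Finset X) (slot : X → (Σ _ : ℕ, γ)) (x : X → ℝ)
    (Cell : ℕ → Finset γ) {V Λ : ℝ} (hV : 0 ≤ V) (hΛ : 0 ≤ Λ) (hcell : ∀ a, ((Cell a).card : ℝ) ≤ V * Λ ^ a)
    (W : ε → ℕ) (step : ε → ℕ) {K : ℕ} (E Bk : ℕ → Finset ε) (hE : ∀ j, ∀ e ∈ E j, step e ∈ Ioc j K) {κ₁ ρbar ηbar : ℝ} (hκ : 0 ≤ κ₁)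
    (ρ : ε → ℝ) (hρ : ∀ j, ∀ b ∈ Bk j, 0 ≤ ρ b) (hρbar : ∀ j, ∑ b ∈ Bk j, ρ b ≤ ρbar) (η : ε → ℝ) (hη : ∀ j, ∀ e ∈ E j, 0 ≤ η e)
    (hηbar : ∀ j, ∀ t ∈ Ioc j K, ∑ e ∈ E j with step e = t, η e ≤ ηbar) (hr : Λ * Real.exp (ηbar - κ₁) < 1)
    {jstar : ℕ} (hj : jstar ≤ K) (hold : ∀ Y ∈ Old, (slot Y).1 < jstar) (hmem : ∀ Y ∈ Old, (slot Y).2 ∈ Cell (K - (slot Y).1))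
    (y : ℕ → γ → ε → Finset ε → ℝ)
    (hfile : ∀ j < jstar, ∀ z ∈ Cell (K - j), ∑ Y ∈ Old with slot Y = ⟨j, z⟩, x Y ≤ ∑ b ∈ Bk j, ∑ Q ∈ records W j K (E j) b, y j z b Q)
    (hy : ∀ j < jstar, ∀ z ∈ Cell (K - j), ∀ b ∈ Bk j, ∀ Q ∈ records W j K (E j) b,
      y j z b Q ≤ ρ b * Real.exp (-(κ₁ * W b)) * ∏ e ∈ Q, (Real.exp (-(κ₁ * W e)) * η e)) :
    ∑ Y ∈ Old, x Y ≤ ρbar * Real.exp (-κ₁) * V * ((Λ * Real.exp (ηbar - κ₁)) ^ (K - jstar + 1) / (1 - Λ * Real.exp (ηbar - κ₁))) := by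
  have hρbar0 : 0 ≤ ρbar := le_trans (Finset.sum_nonneg (hρ 0)) (hρbar 0)
  refine sum_stock_le_twoRate_of_slotPrices Old slot x Cell hV hΛ (mul_nonneg hρbar0 (Real.exp_pos _).le) (Real.exp_pos _).le hr hcell hj hold hmem ?_
  intro j hjlt z hz
  exact (hfile j hjlt z hz).trans (slotPrice_le W (le_trans (le_of_lt hjlt) hj) (E j) (Bk j) step (hE j) hκ ρ (hρ j) (hρbar j) η (hη j)
    (hηbar j) (y j z) (hy j hjlt z hz))

end Stock

/-! ## §3 The weights of the two sockets and the net survival-rate condition -/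

section Weights

/-- The two-rate budget is largest at age one: `C·V·r^{K − j⋆ K + 1}∕(1 − r) ≤ C·V·r∕(1 − r)` (`0 ≤ r < 1`). [folklore] -/
theorem twoRateBudget_le_head {C V r : ℝ} (hC : 0 ≤ C) (hV : 0 ≤ V) (h0 : 0 ≤ r) (h1 : r < 1) (jstar : ℕ → ℕ) (K : ℕ) :
    C * V * (r ^ (K - jstar K + 1) / (1 - r)) ≤ C * V * (r / (1 - r)) := by
  refine mul_le_mul_of_nonneg_left (div_le_div_of_nonneg_right ?_ (by linarith)) (mul_nonneg hC hV)
  calc r ^ (K - jstar K + 1) = r ^ (K - jstar K) * r := pow_succ r _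
    _ ≤ 1 * r := mul_le_mul_of_nonneg_right (pow_le_one₀ h0 h1.le) h0
    _ = r := one_mul r

/-- ★★ **«`W_K < 1`, `Σ_K W_K < ∞`» FOR THE KP-SHAPED WEIGHT** `W_K = 1 − exp(−S_K)` at the two-rate budget `S_K = C·V·r^{K − j⋆(K) + 1}∕(1 − r)`: with `0 < r < 1`, `C, V ≥ 0` and a positive
fraction of old steps `c·K ≤ K − j⋆(K)`, `0 ≤ W_K < 1` for EVERY `K` and `Σ_K W_K < ∞` (`twoRateBudget_nonneg`, `summable_twoRateBudget`, `weightKP_lt_one`, `summable_weightKP` by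
name). [folklore] -/
theorem weightKP_twoRate {C V r c : ℝ} (hC : 0 ≤ C) (hV : 0 ≤ V) (h0 : 0 < r) (h1 : r < 1) (hc : 0 < c) {jstar : ℕ → ℕ}
    (hfrac : ∀ K : ℕ, c * K ≤ ((K - jstar K : ℕ) : ℝ)) :
    (∀ K, 0 ≤ 1 - Real.exp (-(C * V * (r ^ (K - jstar K + 1) / (1 - r))))) ∧
    (∀ K, 1 - Real.exp (-(C * V * (r ^ (K - jstar K + 1) / (1 - r)))) < 1) ∧
    Summable (fun K => 1 - Real.exp (-(C * V * (r ^ (K - jstar K + 1) / (1 - r))))) := by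
  refine ⟨fun K => ?_, fun K => weightKP_lt_one _, summable_weightKP (twoRateBudget_nonneg hC hV h0.le h1 jstar) (summable_twoRateBudget hC hV h0 h1 hc hfrac)⟩
  have : Real.exp (-(C * V * (r ^ (K - jstar K + 1) / (1 - r)))) ≤ 1 :=
    Real.exp_le_one_iff.2 (by linarith [twoRateBudget_nonneg hC hV h0.le h1 jstar K])
  linarith

/-- ★★ **THE SAME FOR THE RAW SOCKET WEIGHT** `exp(S_K) − 1` (p768103's `sum_integral_le_exp_sub_one_mul_sum`, images not assumed good): `0 ≤` always, `Σ_K (exp(S_K) − 1) < ∞` under the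
same fraction condition, and `< 1` for EVERY `K` once the head budget is below `log 2`: `C·V·r∕(1 − r) < log 2`. [folklore] -/
theorem expWeight_twoRate {C V r c : ℝ} (hC : 0 ≤ C) (hV : 0 ≤ V) (h0 : 0 < r) (h1 : r < 1) (hc : 0 < c) {jstar : ℕ → ℕ}
    (hfrac : ∀ K : ℕ, c * K ≤ ((K - jstar K : ℕ) : ℝ)) :
    (∀ K, 0 ≤ Real.exp (C * V * (r ^ (K - jstar K + 1) / (1 - r))) - 1) ∧
    Summable (fun K => Real.exp (C * V * (r ^ (K - jstar K + 1) / (1 - r))) - 1) ∧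
    (C * V * (r / (1 - r)) < Real.log 2 → ∀ K, Real.exp (C * V * (r ^ (K - jstar K + 1) / (1 - r))) - 1 < 1) :=
  ⟨fun K => sub_nonneg.2 (Real.one_le_exp (twoRateBudget_nonneg hC hV h0.le h1 jstar K)),
    summable_expWeight_of_le (twoRateBudget_nonneg hC hV h0.le h1 jstar) (twoRateBudget_le_head hC hV h0.le h1 jstar)
      (summable_twoRateBudget hC hV h0 h1 hc hfrac),
    fun hlog K => expWeight_lt_one_of_lt_log_two ((twoRateBudget_le_head hC hV h0.le h1 jstar K).trans_lt hlog)⟩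

/-- The uniform-window survival rate per step as an exponential: `(e^{E}·e^{−p})^{1∕N} = exp(E∕N − p∕N)`. [folklore] -/
theorem rpow_exp_entropy_credit (E p : ℝ) {N : ℕ} (hN : 0 < N) :
    (Real.exp E * Real.exp (-p)) ^ ((1 : ℝ) / N) = Real.exp (E / N - p / N) := by
  have hN' : (N : ℝ) ≠ 0 := by exact_mod_cast hN.ne'
  rw [← Real.exp_add, ← Real.exp_mul]
  congr 1
  field_simp
  ring

/-- ★ **THE RATE CONDITION OF LINE (E) BY NAME** (`d = 4`: positional entropy `Λ = L⁴` per step of age; record entropy `Γ = e^{E}` and banked credit `ρ = e^{−p}` per event, uniform window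
`N`): `L⁴·(e^{E}e^{−p})^{1∕N} < 1 ↔ 0 < T4WeightBudget.survivalRate p E N L` (`T4PersistentHistoryCount.pow_four_mul_exp_lt_one_iff`). [folklore] -/
theorem twoRate_uniformWindow_lt_one_iff {p E : ℝ} {N L : ℕ} (hN : 0 < N) (hL : 1 ≤ L) :
    ((L : ℝ) ^ 4) * (Real.exp E * Real.exp (-p)) ^ ((1 : ℝ) / N) < 1 ↔ 0 < survivalRate p E N L := by
  rw [rpow_exp_entropy_credit E p hN]
  exact pow_four_mul_exp_lt_one_iff hL

/-- ★ **… WITH THE BANKING FRACTION DISPLAYED**: if the banked credit per event is the fraction `c > 0` of the exponent, `p = c·p₀`, the condition reads `(4∕c)·log L + E∕(c·N) < p₀∕N` —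
LOCATED-5 §3's «`r < 1` iff `p₀∕N > (4∕c)·log L`» with the record entropy made explicit (`T4WeightBudget.survivalRate_pos_iff`). [folklore] -/
theorem survivalRate_banked_pos_iff {c p₀ E N L : ℝ} (hc : 0 < c) (hN : 0 < N) :
    0 < survivalRate (c * p₀) E N L ↔ 4 / c * Real.log L + E / (c * N) < p₀ / N := by
  have hc' : c ≠ 0 := hc.ne'
  have hN' : N ≠ 0 := hN.ne'
  have key : 4 / c * Real.log L + E / (c * N) = (4 * Real.log L + E / N) / c := by
    field_simp
  rw [survivalRate_pos_iff hN, key, div_lt_iff₀ hc, show p₀ / N * c = c * p₀ / N by ring]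

end Weights

/-! ## §4 Assembly: `RelWeightBound` from the KP-shaped per-run inequalities; of record on the dressed class weights -/

section Assembly

variable {ι : Type*} {l₀ : ℝ} {T : ℕ → Finset ι} {A B : ℕ → ℝ → ι → ℝ} {Bad : ℕ → ℝ → Finset ι} {S : ℕ → ℝ}

/-- ★★ **`RelWeightBound` FROM THE KP-SHAPED INEQUALITIES OF BOTH RUNS**: `Bad ⊆ T`, a common majorant `S ≥ 0` with `Σ_K S K < ∞`, and per `(K, t)`, `|t| ≤ l₀`, for each run
`Σ_{Bad} ≤ (1 − exp(−S K))·Σ_{T}` (§1's shape at the class weights of the run) ⇒ `RelWeightBound l₀ T A B Bad (K ↦ 1 − exp(−S K))` — `0 ≤ W_K < 1` and `Σ W < ∞` by `T4WeightBudgetKP`'s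
one-liners; the same where-block as `T4PeierlsDomination.relWeightBound_of_peierlsDom` without the slot structure. [folklore] -/
theorem relWeightBound_of_weightKP_le (hS0 : ∀ K, 0 ≤ S K) (hS : Summable S) (hsub : ∀ K t, |t| ≤ l₀ → Bad K t ⊆ T K)
    (hA : ∀ K t, |t| ≤ l₀ → ∑ τ ∈ Bad K t, A K t τ ≤ (1 - Real.exp (-S K)) * ∑ τ ∈ T K, A K t τ)
    (hB : ∀ K t, |t| ≤ l₀ → ∑ τ ∈ Bad K t, B K t τ ≤ (1 - Real.exp (-S K)) * ∑ τ ∈ T K, B K t τ) :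
    RelWeightBound l₀ T A B Bad (fun K => 1 - Real.exp (-S K)) where
  bad_subset := hsub
  nonneg K := by
    have : Real.exp (-S K) ≤ 1 := Real.exp_le_one_iff.2 (by linarith [hS0 K])
    linarith
  lt_one K := weightKP_lt_one (S K)
  summable := summable_weightKP hS0 hS
  bad_left := hA
  bad_right := hB

/-- ★★ **… AT THE TWO-RATE BUDGET** `S K = C·V·r^{K − j⋆(K) + 1}∕(1 − r)` (`0 < r < 1`, `C, V ≥ 0`, `c·K ≤ K − j⋆(K)`): the signs and the summability discharged by name. [folklore] -/
theorem relWeightBound_twoRate_of_weightKP_le {C V r c : ℝ} (hC : 0 ≤ C) (hV : 0 ≤ V) (h0 : 0 < r) (h1 : r < 1) (hc : 0 < c) {jstar : ℕ → ℕ}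
    (hfrac : ∀ K : ℕ, c * K ≤ ((K - jstar K : ℕ) : ℝ)) (hsub : ∀ K t, |t| ≤ l₀ → Bad K t ⊆ T K)
    (hA : ∀ K t, |t| ≤ l₀ → ∑ τ ∈ Bad K t, A K t τ ≤ (1 - Real.exp (-(C * V * (r ^ (K - jstar K + 1) / (1 - r))))) * ∑ τ ∈ T K, A K t τ)
    (hB : ∀ K t, |t| ≤ l₀ → ∑ τ ∈ Bad K t, B K t τ ≤ (1 - Real.exp (-(C * V * (r ^ (K - jstar K + 1) / (1 - r))))) * ∑ τ ∈ T K, B K t τ) :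
    RelWeightBound l₀ T A B Bad (fun K => 1 - Real.exp (-(C * V * (r ^ (K - jstar K + 1) / (1 - r))))) :=
  relWeightBound_of_weightKP_le (twoRateBudget_nonneg hC hV h0.le h1 jstar) (summable_twoRateBudget hC hV h0 h1 hc hfrac) hsub hA hB

end Assembly

section Record

open scoped Classical

variable {F : T4Family} {N : ℕ} [NeZero N]
variable (ϑ : Stage9Params F N) (D : FiniteEpsData F (SU N)) (g₀ : ℕ → ℝ) (os : List (ULoop F)) (p : B12.RunParams) (g : ℕ → ℝ) (k : ℕ) (t : ℝ)

/-! THE DATA OF ROAD [e] AT ONE `(p, g, k, t)` (displayed once for the three theorems of record): ANY bad set `B` of level-`k` sequences of record, a removal map `rm` landing OUTSIDE `B`,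
fibre sets `fib`, factors `z`; the provisos on the pieces `χ_k(s)·slot_k(s)` (measurable, `≥ 0`, integrable — def-T ∕ K0c shapes); the letter hDom «`∫⌈_{fib s}(χ_k(s)·slot_k(s)) ≤
z s · ∫⌈_{fib s}(χ_k(rm s)·slot_k(rm s))` at every `V`, `s ∈ B`» (a HYPOTHESIS — the ESTIMATE); the fibre injections `φ σ` into the non-empty compatible sub-families of the stocks `Old σ`
with `z s ≤ Π x` (DATA — the DEFINER object). -/
variable {X : Type*} (B : Finset (SeqOfRecord F ϑ.ν ϑ.τ9.M g p.K k)) (rm : SeqOfRecord F ϑ.ν ϑ.τ9.M g p.K k → SeqOfRecord F ϑ.ν ϑ.τ9.M g p.K k)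
  (fib : SeqOfRecord F ϑ.ν ϑ.τ9.M g p.K k → Finset (PBond (F.P p.K) k)) (z : SeqOfRecord F ϑ.ν ϑ.τ9.M g p.K k → ℝ)
  (hm : ∀ s, Measurable fun V => chiSeqOfRecord F N ϑ.ν ϑ.τ9.M g p.K k s V * dressedSlotsOfDatum₉ F N ϑ D g₀ os t p g k s V)
  (h0 : ∀ s V, 0 ≤ chiSeqOfRecord F N ϑ.ν ϑ.τ9.M g p.K k s V * dressedSlotsOfDatum₉ F N ϑ D g₀ os t p g k s V)
  (hint : ∀ s, Integrable (fun V => chiSeqOfRecord F N ϑ.ν ϑ.τ9.M g p.K k s V * dressedSlotsOfDatum₉ F N ϑ D g₀ os t p g k s V) (fieldMeasure (F.P p.K) k (SU N)))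
  (hDom : ∀ s ∈ B, ∀ V,
    fibreIntegral (fib s) (fun V => chiSeqOfRecord F N ϑ.ν ϑ.τ9.M g p.K k s V * dressedSlotsOfDatum₉ F N ϑ D g₀ os t p g k s V) V ≤
      z s * fibreIntegral (fib s) (fun V => chiSeqOfRecord F N ϑ.ν ϑ.τ9.M g p.K k (rm s) V * dressedSlotsOfDatum₉ F N ϑ D g₀ os t p g k (rm s) V) V)
  (hgood : ∀ s ∈ B, rm s ∉ B)
  (Old : SeqOfRecord F ϑ.ν ϑ.τ9.M g p.K k → Finset X) (φ : SeqOfRecord F ϑ.ν ϑ.τ9.M g p.K k → SeqOfRecord F ϑ.ν ϑ.τ9.M g p.K k → Finset X) (x : X → ℝ)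
  (hx : ∀ σ, ∀ Y ∈ Old σ, 0 ≤ x Y) (hφ : ∀ σ, ∀ s ∈ B.filter (fun s => rm s = σ), φ σ s ⊆ Old σ ∧ (φ σ s).Nonempty)
  (hinj : ∀ σ, Set.InjOn (φ σ) (B.filter (fun s => rm s = σ))) (hz : ∀ σ, ∀ s ∈ B.filter (fun s => rm s = σ), z s ≤ ∏ Y ∈ φ σ s, x Y)

include hm h0 hint hDom hgood hx hφ hinj hz

/-- ★★★ **N20's BAD-CLASS INEQUALITY AT ONE `(p, g, k, t)` IN THE KP SHAPE**: the data of road [e] (above) with GOOD images and the uniform smallness `Σ_{Old σ} x ≤ w` ⇒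
`Σ_{s∈B} cw_k(s) ≤ (1 − exp(−w)) · Σ_s cw_k(s)` for `cw = classWeightOfDatum₉` (§1 on the dressed pieces). [bookkeeping] -/
theorem sum_classWeightOfDatum₉_le_weightKP_mul_sum_of_fibreDom {w : ℝ} (hw : ∀ σ, ∑ Y ∈ Old σ, x Y ≤ w) :
    ∑ s ∈ B, classWeightOfDatum₉ F N ϑ D g₀ os p g k t s ≤ (1 - Real.exp (-w)) * ∑ s, classWeightOfDatum₉ F N ϑ D g₀ os p g k t s := by
  unfold classWeightOfDatum₉
  exact sum_integral_le_weightKP_mul_sum_of_fibreDom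
    (fun s V => chiSeqOfRecord F N ϑ.ν ϑ.τ9.M g p.K k s V * dressedSlotsOfDatum₉ F N ϑ D g₀ os t p g k s V) fib B rm z hm h0 hint hDom hgood Old φ x hx hφ hinj hz hw

/-- ★★★ **… WITH `w` DISCHARGED BY THE SLOT BUDGET**: the stocks filed under birth slots (`slot σ Y = ⟨j, c⟩`, `j < j⋆ ≤ k`, `c ∈ Cell (k − j)`, `#Cell a ≤ V·Λ^a`) with the activities at each
slot adding up to at most `C·σ₁^{k − j}` ⇒ `Σ_{s∈B} cw_k(s) ≤ (1 − exp(−C·V·(Λσ₁)^{k − j⋆ + 1}∕(1 − Λσ₁))) · Σ_s cw_k(s)` whenever `Λσ₁ < 1`. [bookkeeping] -/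
theorem sum_classWeightOfDatum₉_le_weightKP_mul_sum_of_slotPrices {γ : Type*} (slot : SeqOfRecord F ϑ.ν ϑ.τ9.M g p.K k → X → (Σ _ : ℕ, γ)) (Cell : ℕ → Finset γ)
    {V Λ C σ₁ : ℝ} (hV : 0 ≤ V) (hΛ : 0 ≤ Λ) (hC : 0 ≤ C) (hσ : 0 ≤ σ₁) (hr : Λ * σ₁ < 1) (hcell : ∀ a, ((Cell a).card : ℝ) ≤ V * Λ ^ a) {jstar : ℕ} (hj : jstar ≤ k)
    (hold : ∀ σ, ∀ Y ∈ Old σ, (slot σ Y).1 < jstar) (hmem : ∀ σ, ∀ Y ∈ Old σ, (slot σ Y).2 ∈ Cell (k - (slot σ Y).1))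
    (hprice : ∀ σ, ∀ j < jstar, ∀ c ∈ Cell (k - j), ∑ Y ∈ Old σ with slot σ Y = ⟨j, c⟩, x Y ≤ C * σ₁ ^ (k - j)) :
    ∑ s ∈ B, classWeightOfDatum₉ F N ϑ D g₀ os p g k t s ≤
      (1 - Real.exp (-(C * V * ((Λ * σ₁) ^ (k - jstar + 1) / (1 - Λ * σ₁))))) * ∑ s, classWeightOfDatum₉ F N ϑ D g₀ os p g k t s :=
  sum_classWeightOfDatum₉_le_weightKP_mul_sum_of_fibreDom ϑ D g₀ os p g k t B rm fib z hm h0 hint hDom hgood Old φ x hx hφ hinj hz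
    fun σ => sum_stock_le_twoRate_of_slotPrices (Old σ) (slot σ) x Cell hV hΛ hC hσ hr hcell hj (hold σ) (hmem σ) (hprice σ)

/-- ★★★ **… WITH `w` DISCHARGED BY LINE (E)'s SENTENCE (banked renewals, uniform window)**: the stocks filed under birth slots; at each slot the activities add up to at most the costs of the
records filed there; a record with `m` events costs `≤ ρ^{m}` (banked credit `ρ = e^{−p}`, `p = c·p₀(g_K)` — NOT PRINTED), at most `Γ^{k′}` records with `k′` events, every record has
`≥ m₀ j` events with `k + 1 − j ≤ N_w·(m₀ j + 1)` (uniform window) ⇒ `Σ_{s∈B} cw_k(s) ≤ (1 − exp(−S)) · Σ_s cw_k(s)` with `S = (Γρ)⁻¹∕(1−Γρ)·V·r^{k − j⋆ + 1}∕(1 − r)`,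
`r = Λ·(Γρ)^{1∕N_w} < 1` (↔ `0 < survivalRate p E N_w L` at `Λ = L⁴`, `Γ = e^{E}`, §3). [bookkeeping] -/
theorem sum_classWeightOfDatum₉_le_weightKP_mul_sum_of_uniformWindow {γ R : Type*} (slot : SeqOfRecord F ϑ.ν ϑ.τ9.M g p.K k → X → (Σ _ : ℕ, γ))
    (Cell : ℕ → Finset γ) {V Λ ρ Γ : ℝ} (hV : 0 ≤ V) (hΛ : 0 ≤ Λ) (hρ : 0 ≤ ρ) (hΓ : 0 ≤ Γ) (hq0 : 0 < Γ * ρ) (hq1 : Γ * ρ < 1) {Nw : ℕ} (hN : 0 < Nw)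
    (hr : Λ * (Γ * ρ) ^ ((1 : ℝ) / Nw) < 1) (hcell : ∀ a, ((Cell a).card : ℝ) ≤ V * Λ ^ a) {jstar : ℕ} (hj : jstar ≤ k)
    (hold : ∀ σ, ∀ Y ∈ Old σ, (slot σ Y).1 < jstar) (hmem : ∀ σ, ∀ Y ∈ Old σ, (slot σ Y).2 ∈ Cell (k - (slot σ Y).1))
    (Rec : SeqOfRecord F ϑ.ν ϑ.τ9.M g p.K k → ℕ → γ → Finset R) (m : ℕ → γ → R → ℕ) (c : ℕ → γ → R → ℝ) (m₀ : ℕ → ℕ)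
    (hfile : ∀ σ, ∀ j < jstar, ∀ cz ∈ Cell (k - j), ∑ Y ∈ Old σ with slot σ Y = ⟨j, cz⟩, x Y ≤ ∑ r ∈ Rec σ j cz, c j cz r)
    (hc : ∀ σ, ∀ j < jstar, ∀ cz ∈ Cell (k - j), ∀ r ∈ Rec σ j cz, c j cz r ≤ ρ ^ m j cz r)
    (hcount : ∀ σ, ∀ j < jstar, ∀ cz ∈ Cell (k - j), ∀ k', (((Rec σ j cz).filter fun r => m j cz r = k').card : ℝ) ≤ Γ ^ k')
    (hmin : ∀ σ, ∀ j < jstar, ∀ cz ∈ Cell (k - j), ∀ r ∈ Rec σ j cz, m₀ j ≤ m j cz r) (hwin : ∀ j < jstar, k + 1 - j ≤ Nw * (m₀ j + 1)) :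
    ∑ s ∈ B, classWeightOfDatum₉ F N ϑ D g₀ os p g k t s ≤
      (1 - Real.exp (-((Γ * ρ)⁻¹ / (1 - Γ * ρ) * V *
        ((Λ * (Γ * ρ) ^ ((1 : ℝ) / Nw)) ^ (k - jstar + 1) / (1 - Λ * (Γ * ρ) ^ ((1 : ℝ) / Nw)))))) * ∑ s, classWeightOfDatum₉ F N ϑ D g₀ os p g k t s :=
  sum_classWeightOfDatum₉_le_weightKP_mul_sum_of_fibreDom ϑ D g₀ os p g k t B rm fib z hm h0 hint hDom hgood Old φ x hx hφ hinj hz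
    fun σ => sum_stock_le_twoRate_of_uniformWindow (Old σ) (slot σ) x Cell hV hΛ hρ hΓ hq0 hq1 hN hr hcell hj (hold σ) (hmem σ) (Rec σ) m c m₀
      (hfile σ) (hc σ) (hcount σ) (hmin σ) hwin

end Record

end YMDAG.UVSplit
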